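import Summits.QuantumFields.BalabanUV.Beta.D1BFx.VectorLegEquation
import Summits.QuantumFields.BalabanUV.Beta.D1BFx.LandauResolventSuperposition
import Summits.QuantumFields.BalabanUV.Beta.D1BFx.LandauDictionaryGammaReadout
import Summits.QuantumFields.BalabanUV.Beta.D1BFx.GluonLegTails

/-!
# `BalabanUV.Beta.D1BFx.LandauDictionaryInstance` — road «BF-x» for binder row D1, slot (K): THE KERNEL DICTIONARY FOR THE ROAD'S OWN LEGS,
# with X₁a DISCHARGED — (D-H) `Ga𝒬ᵀω = H(𝒬Ga𝒬ᵀω)`, the coarse identity (X₁b) and (D-Γ) `Gam = ½·(Ga·δ − d𝔅δ-term − H(𝒬Ga·δ))` for `Ga = GluonLeg.Ga (m+1) a = K^∞`,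
# MODULO ONLY the two PRINTED statements [B5, Prop. 1.2] ∧ [B5, (1.126)–(1.127)] (quoted `def`s, as in the road's END) that supply the decay of `Ga`

HONEST FRAMING (cell contract, verbatim): «discharging `BetaPertH` makes Bałaban's UV stability UNCONDITIONAL — a real constructive-QFT
result; it is NOT the continuum limit and NOT the Clay problem.»  HONEST DEPENDENCY (verbatim): «continuum YM on T⁴ ⇐ BetaPertH ∧ nine
spine estimates (0/9 proved); BetaPertH ⇐ (D1) ∧ (D4) ∧ CAP+tail; G-an2-4 gates asym, D1 and NE2/3/4.»  THIS MODULE DISCHARGES NOTHING of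
D1 / BetaPertH: it INSTANTIATES, by name, leaf-06-g6's dictionary bricks (`LandauDictionaryGammaReadout.gam_eq_of_force_w`, B7) and this
lineage's (`LandauResolventSuperposition.dictH_superposed` / `X1b_of_X1a`, B6′) at the road's legs, with the displayed hypothesis `hX1a` now
SUPPLIED by the theorem `VectorLegEquation.vectorLeg_equation_weighted` (X₁a, this lineage) and the decay `Spr (Ga (m+1) a)` by
`GluonLegTails.spr_Ga_of_prop12` from the two PRINTED statements `B5.Prop12Printed` / `B5.Kernel126_127Printed` (quoted `def`s of the typed
paper B5 — referee I-capref88-1: dischargeable only as the printed statements, cited; they are the SAME two binders `h12`/`h126` the road's END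
`RoadEndBFxTotalShell.d1Drift_BFx_total_shell_of_prop12` carries, nothing new).  No `def`, no `Prop` is minted, nothing else is cited, 0 sorry.
NOT summit progress; NOT BetaPertH, NOT continuum, NOT Clay.

ABSOLUTE RULE (cell, verbatim): «No internally-minted statement may enter as a cited fact. Every hypothesis is either kernel-proved in this
package or a verbatim quotation of a PUBLISHED theorem with page reference. The manuscript(s) under audit are NOT citable for their own
disputed steps — they are the thing under adjudication; programme-internal (2001/route/tribunal) claims are never citable.»

WHY (K-R1-SPEC v2 §2/§4; `DICT-BRICKS.md` v1.3; `X1-SPEC.md`).  With X₁a a theorem, the dictionary between the typed sharp resolvent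
(`KernelSpecInstance.wH/wΦ/wM` as the superposition `Hop/Φop/Mop`, `KKTFluctuationKernel.Gam/GamΦ/GamM`) and the road's R-weighted legs holds for
the ACTUAL legs `Ga (m+1) a` at every block side `m + 1 ≥ 1` and every `a > 0`, conditionally ONLY on the printed decay input — exactly the
standing of every other leaf of the road.  What slot (K) still owes after this file: X₂ (the row's Ward letters), X₃(ii) (kernel transcription of
`mixedVar_sliceTransfer_jets`), X₄ (K-R4).

CONTENT (an5 level / road block side `m + 1`, `a > 0`; constants of record `r = 2`, `c = 2`, `a′ = 2a/(m+1)⁸`).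
* `hX1a_Ga` — X₁a in the displayed shape, for `Ga (m+1) a` (= `vectorLeg_equation_weighted`).
* **`dictH_Ga`** — (D-H) for every bounded coarse source `ω`, modulo `h12 ∧ h126`.
* **`coarse_identity_Ga`**, **`X1b_Ga`** — the coarse identity / X₁b for the road's legs, modulo `h12 ∧ h126`.
* **`gam_Ga`** — (D-Γ): the typed fluctuation covariance column in terms of `Ga`, the bi-Laplacian block term and `Hop`, modulo `h12 ∧ h126`.
Unit `b2b-balaban-beta-d1-p2` (road owner, gen 5).
-/

namespace Summit.QuantumFields.BalabanUV.Beta.D1BFx.LandauDictionaryInstance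

open Finset
open scoped BigOperators
open Literature.MathematicalPhysics.QuantumFieldTheory.Balaban1983to89
open Literature.MathematicalPhysics.QuantumFieldTheory.Balaban1983to89.Beta
open ExpKernelCalculus (Site MKer Decays)
open AffineAveraging (Form0 Form1 unitVec dz curv curvAdj codiff₁ contourSum)
open AffineReproduction (contourSumAdj)
open KKTFluctuationKernel (delta1 Gam GamΦ GamM)
open KernelSpecInstance (wH wΦ wM Hop Φop Mop)
open BiLaplaceBlockKKT (Sb)
open VectorTailsLoc (fam kfam)
open Summit.QuantumFields.BalabanUV.Beta.TameKernelCalculus (Spr)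
open Summit.QuantumFields.BalabanUV.Beta.D1BFx.KernelFormOperators (kerOp₁ Rf)
open Summit.QuantumFields.BalabanUV.Beta.D1BFx.TowerEquationForms (Gf)
open Summit.QuantumFields.BalabanUV.Beta.D1BFx.GluonLeg (Ga)
open Summit.QuantumFields.BalabanUV.Beta.D1BFx.FrozenLegTails (nOf MOf hn1)
open Summit.QuantumFields.BalabanUV.Beta.D1BFx.GluonLegTails (spr_Ga_of_prop12)
open Summit.QuantumFields.BalabanUV.Beta.D1BFx.VectorLegEquation (vectorLeg_equation_weighted)
open Summit.QuantumFields.BalabanUV.Beta.D1BFx.LandauResolventSuperposition (dictH_superposed coarse_identity X1b_of_X1a unitSrc)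
open Summit.QuantumFields.BalabanUV.Beta.D1BFx.LandauDictionaryGammaReadout (gam_eq_of_force_w)

noncomputable section

variable (m : ℕ) {a : ℝ} (ha : 0 < a)

include ha in
/-- [folklore] **X₁a FOR THE ROAD'S LEGS, DISPLAYED SHAPE** (`r = 2`, `c = 2`, `a′ = 2a/(m+1)⁸`): `VectorLegEquation.vectorLeg_equation_weighted`. -/
theorem hX1a_Ga : ∀ (l : Fin 4) (z : Site 4) (κ : Fin 4) (x : Site 4),
    curvAdj (curv (fun κ' p => Ga (m + 1) a p z κ' l)) κ x
      = 2 * delta1 l z κ x - 2 * dz (Rf (m + 1) a (codiff₁ (fun κ' p => Ga (m + 1) a p z κ' l))) κ x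
        - (2 * a / ((m + 1 : ℕ) : ℝ) ^ 8) * contourSumAdj (m + 1) (contourSum (m + 1) (fun κ' p => Ga (m + 1) a p z κ' l)) κ x :=
  fun l z κ x => vectorLeg_equation_weighted m a ha l z κ x

/-- [folklore] **(D-H) FOR THE ROAD'S LEGS, MODULO [B5, Prop. 1.2] ∧ [B5, (1.126)–(1.127)] BY NAME**: for every bounded coarse source `ω`, the
R-weighted column `Ga𝒬ᵀω`, its multiplier `2•ω − (2a/(m+1)⁸)•𝒬(Ga𝒬ᵀω)` and its gauge multiplier are the typed superposition `(H, Φ, M)` against the data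
`𝒬(Ga𝒬ᵀω)`. -/
theorem dictH_Ga (h12 : B5.Prop12Printed (fam nOf hn1 MOf a ha)) (h126 : B5.Kernel126_127Printed (kfam nOf MOf))
    {ω : Form1 4 ℝ} {Mω : ℝ} (hω : ∀ κ y, |ω κ y| ≤ Mω) :
    kerOp₁ (Ga (m + 1) a) (contourSumAdj (m + 1) ω) = Hop (N := m + 1) (contourSum (m + 1) (kerOp₁ (Ga (m + 1) a) (contourSumAdj (m + 1) ω)))
      ∧ (fun κ y => 2 * ω κ y - (2 * a / ((m + 1 : ℕ) : ℝ) ^ 8) * contourSum (m + 1) (kerOp₁ (Ga (m + 1) a) (contourSumAdj (m + 1) ω)) κ y)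
          = Φop (N := m + 1) (contourSum (m + 1) (kerOp₁ (Ga (m + 1) a) (contourSumAdj (m + 1) ω)))
      ∧ (fun p => -(2 * ((m + 1 : ℕ) : ℝ) ^ 2) * Gf (m + 1) a (Rf (m + 1) a (codiff₁ (kerOp₁ (Ga (m + 1) a) (contourSumAdj (m + 1) ω)))) p)
          = Mop (N := m + 1) (contourSum (m + 1) (kerOp₁ (Ga (m + 1) a) (contourSumAdj (m + 1) ω))) := by
  obtain ⟨C, δ, hδ, hGa⟩ := spr_Ga_of_prop12 ha h12 h126 (m + 1)
  exact dictH_superposed (m + 1) a ha two_ne_zero hGa hδ hω (hX1a_Ga m ha)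

/-- [folklore] **THE COARSE IDENTITY FOR THE ROAD'S LEGS, MODULO [B5, Prop. 1.2] ∧ [B5, (1.126)–(1.127)] BY NAME**:
`2·ω κ y = (2a/(m+1)⁸)·(𝒬Ga𝒬ᵀω) κ y + Σ'_{y′} Σ_l wΦ κ l (y − y′)·(𝒬Ga𝒬ᵀω) l y′`. -/
theorem coarse_identity_Ga (h12 : B5.Prop12Printed (fam nOf hn1 MOf a ha)) (h126 : B5.Kernel126_127Printed (kfam nOf MOf))
    {ω : Form1 4 ℝ} {Mω : ℝ} (hω : ∀ κ y, |ω κ y| ≤ Mω) (κ : Fin 4) (y : Site 4) :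
    2 * ω κ y = (2 * a / ((m + 1 : ℕ) : ℝ) ^ 8) * contourSum (m + 1) (kerOp₁ (Ga (m + 1) a) (contourSumAdj (m + 1) ω)) κ y
      + ∑' y' : Site 4, ∑ l, wΦ (N := m + 1) κ l (y - y') * contourSum (m + 1) (kerOp₁ (Ga (m + 1) a) (contourSumAdj (m + 1) ω)) l y' := by
  obtain ⟨C, δ, hδ, hGa⟩ := spr_Ga_of_prop12 ha h12 h126 (m + 1)
  exact coarse_identity (m + 1) a ha two_ne_zero hGa hδ hω (hX1a_Ga m ha) κ y

/-- [folklore] **X₁b FOR THE ROAD'S LEGS, MODULO [B5, Prop. 1.2] ∧ [B5, (1.126)–(1.127)] BY NAME**: with `Φ̃ := 𝒬Ga𝒬ᵀ` (the column at the coarse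
bond `(l₀, y₀)`), `2·δ = (2a/(m+1)⁸)·Φ̃ + wΦ ⋆ Φ̃` — i.e. `(½wΦ + a/(m+1)⁸)·(𝒬Ga𝒬ᵀ) = 1`, so the tree's `CoarseLeg.Cun = ((m+1)⁸/2)wΦ + a` inverts `𝒬Ga𝒬ᵀ`
up to `(m+1)⁸`. -/
theorem X1b_Ga (h12 : B5.Prop12Printed (fam nOf hn1 MOf a ha)) (h126 : B5.Kernel126_127Printed (kfam nOf MOf))
    (l₀ : Fin 4) (y₀ : Site 4) (κ : Fin 4) (y : Site 4) :
    2 * (if y = y₀ ∧ κ = l₀ then (1 : ℝ) else 0)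
      = (2 * a / ((m + 1 : ℕ) : ℝ) ^ 8) * contourSum (m + 1) (kerOp₁ (Ga (m + 1) a) (contourSumAdj (m + 1) (unitSrc l₀ y₀))) κ y
        + ∑' y' : Site 4, ∑ l, wΦ (N := m + 1) κ l (y - y')
            * contourSum (m + 1) (kerOp₁ (Ga (m + 1) a) (contourSumAdj (m + 1) (unitSrc l₀ y₀))) l y' := by
  obtain ⟨C, δ, hδ, hGa⟩ := spr_Ga_of_prop12 ha h12 h126 (m + 1)
  exact X1b_of_X1a (m + 1) a ha two_ne_zero hGa hδ (hX1a_Ga m ha) l₀ y₀ κ y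

/-- [folklore] **(D-Γ) FOR THE ROAD'S LEGS, MODULO [B5, Prop. 1.2] ∧ [B5, (1.126)–(1.127)] BY NAME** (leaf-06-g6's `gam_eq_of_force_w` at the
road's legs and the constants of record): the typed fluctuation covariance column is
`Gam(·; l, x′) = ½•(Ga·δ_{(l,x′)} − d(𝔅-term) − H(𝒬(Ga·δ_{(l,x′)})))`, with its two multipliers. -/
theorem gam_Ga (h12 : B5.Prop12Printed (fam nOf hn1 MOf a ha)) (h126 : B5.Kernel126_127Printed (kfam nOf MOf)) (l : Fin 4) (x' : Site 4) :
    (fun κ x => Gam (N := m + 1) κ x l x')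
        = (2 : ℝ)⁻¹ • (kerOp₁ (Ga (m + 1) a) (delta1 l x')
            - ((2 : ℝ) / 2) • dz (fun p => ∑ z ∈ ({x', x' + unitVec l} : Finset (Site 4)), codiff₁ (delta1 l x') z * Sb (N := m + 1) p z)
            - Hop (N := m + 1) (contourSum (m + 1) (kerOp₁ (Ga (m + 1) a) (delta1 l x'))))
      ∧ (fun κ q => GamΦ (N := m + 1) κ q l x')
        = (2 : ℝ)⁻¹ • ((fun κ y => -((2 * a / ((m + 1 : ℕ) : ℝ) ^ 8) * contourSum (m + 1) (kerOp₁ (Ga (m + 1) a) (delta1 l x')) κ y))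
            - Φop (N := m + 1) (contourSum (m + 1) (kerOp₁ (Ga (m + 1) a) (delta1 l x'))))
      ∧ (fun z => GamM (N := m + 1) z l x')
        = (2 : ℝ)⁻¹ • ((fun p => -(2 * ((m + 1 : ℕ) : ℝ) ^ 2) * Gf (m + 1) a (Rf (m + 1) a (codiff₁ (kerOp₁ (Ga (m + 1) a) (delta1 l x')))) p)
            - Mop (N := m + 1) (contourSum (m + 1) (kerOp₁ (Ga (m + 1) a) (delta1 l x')))) := by
  obtain ⟨C, δ, hδ, hGa⟩ := spr_Ga_of_prop12 ha h12 h126 (m + 1)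
  exact gam_eq_of_force_w (m + 1) a ha two_ne_zero two_ne_zero hGa hδ (hX1a_Ga m ha) l x'

end

end Summit.QuantumFields.BalabanUV.Beta.D1BFx.LandauDictionaryInstance
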